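import Summits.QuantumAdvantage.QuantumAdvantage.Theorems.ArithStatLadderIqThreeNotPPolyStubHittingSet
import Summits.QuantumAdvantage.QuantumAdvantage.Theorems.ArithStatLadderIqThreeNotPPolyStubSeedListPPoly
import Literature.Computability.Complexity.CircuitClassesProofs
import Literature.Computability.Complexity.CircuitComposition
import Literature.Computability.Complexity.LupanovBound
import Literature.Computability.Complexity.PPolyComplement
import Literature.Computability.AlgebraicComplexity.BurgisserThm41Proofs

/-!
# Crux `ArithStatLadder.IqThreeNotPPoly` (stmt-QuantumAdvantage-2422): `P/poly` is closed under one-sided randomized reductions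

Glue of the line `Sketch` (SQUAREFREE-FILTER DOMINATION), complexity half: **Adleman's argument
relativised to a one-sided randomized (RUR-type) polynomial-time many-one reduction with success
probability only `≥ 1/q(n)` from some length `n₀` on.** If `f ∈ FP`, every NO-instance `x ∉ L₁` is
mapped OUTSIDE `L₂` for every seed (`f ⟨x, r⟩ ∉ L₂`), every YES-instance `x ∈ L₁` of length
`n ≥ n₀` is mapped INTO `L₂` for at least a `1/q(n)` fraction of the seeds `r ∈ {0,1}^{ℓ(n)}`
(`ℓ ≤ q`), and `L₂ ∈ P/poly`, then `L₁ ∈ P/poly` (`mem_PPoly_of_rurReduction`).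

Proof: at each length `n ≥ n₀` the landed hitting-set lemma (`stub_hittingSet`,
`…StubHittingSet.lean`) gives `(n+1)·q(n)` seeds hitting the good-seed set of every YES-instance of
that length; the language "some listed seed maps `x` into `L₂`" is in `P/poly` by the landed
derandomised decider (`stub_seedListPPoly`, `…StubSeedListPPoly.lean`); it agrees with `L₁` from
length `n₀` on because the NO side is exact; and a language agreeing with a `P/poly` language on all
long words is in `P/poly` (`mem_PPoly_of_eventually_agree`: a language of words of bounded length has
Lupanov circuits below the bound and a constant gate above it, `mem_PPoly_of_forall_length_lt` — the
argument of the landed `Negative.mem_PPoly_of_finite`, restated for a length bound so that this file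
does not depend on the route file). References: L. Adleman, *Two theorems on random polynomial time*,
FOCS 1978 (`BPP ⊆ P/poly`); D. Micciancio, SIAM J. Comput. 30 (2001), §2 (RUR reductions: no false
positives, YES preserved with non-negligible probability). Theorems only; sorry-free.
-/

set_option linter.dupNamespace false -- D-0017: single-problem summit ⇒ `QuantumAdvantage.QuantumAdvantage` by design

noncomputable section

namespace Summit.QuantumAdvantage.QuantumAdvantage.Theorems.IqThreeNotPPoly

open scoped Classical
open _root_.Computability Literature.Computability.Complexity
/-! ### Small closure facts -/

/-- **A language all of whose words are shorter than `n₀` is in `P/poly`**: Lupanov circuits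
(`cktSize_lupanov`) at lengths `< n₀`, the constant `false` gate at lengths `≥ n₀`; the size bound is
the constant polynomial `max_{n < n₀} lupanovBound n + 1`. (The argument of the landed
`Negative.mem_PPoly_of_finite`, for a length bound.) [folklore] -/
theorem mem_PPoly_of_forall_length_lt {L : Language Bool} (n₀ : ℕ)
    (hL : ∀ x : List Bool, x ∈ L → x.length < n₀) : L ∈ PPoly := by
  have keyS : ∀ n, ∃ C : Circuit (Fin n), C.IsOver B2 ∧ C.size ≤ lupanovBound n ∧
      ∀ x, C.eval x = L.boolIndicator (List.ofFn x) := fun n =>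
    (cktSize_lupanov (n := n) fun v (_ : Unit) => L.boolIndicator (List.ofFn v)).toCircuit
  have keyL : ∀ n, ∃ C : Circuit (Fin n), C.IsOver B2 ∧ C.size ≤ 1 ∧ ∀ x, C.eval x = false :=
    fun n => (cktSize_const (Fin n) false).toCircuit
  choose CS hCS using keyS
  choose CL hCL using keyL
  refine Set.mem_iUnion.2 ⟨Polynomial.C ((Finset.range n₀).sup lupanovBound + 1),
    fun n => if n < n₀ then CS n else CL n, fun n => ?_, fun x => ?_⟩
  · by_cases hn : n < n₀
    · simp only [hn, if_true, Polynomial.eval_C]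
      refine ⟨(hCS n).1, (hCS n).2.1.trans ?_⟩
      have : lupanovBound n ≤ (Finset.range n₀).sup lupanovBound :=
        Finset.le_sup (f := lupanovBound) (Finset.mem_range.2 hn)
      omega
    · simp only [hn, if_false, Polynomial.eval_C]
      exact ⟨(hCL n).1, (hCL n).2.1.trans (by omega)⟩
  · show (if x.length < n₀ then CS x.length else CL x.length).eval x.get = L.boolIndicator x
    by_cases hx : x.length < n₀
    · simp only [hx, if_true]
      rw [(hCS x.length).2.2, List.ofFn_get]
    · simp only [hx, if_false]
      rw [(hCL x.length).2.2]
      have hxL : x ∉ L := fun h => hx (hL x h)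
      exact ((L.notMem_iff_boolIndicator x).1 hxL).symm

/-- Membership in a join of languages (definitional). -/
theorem mem_sup_language_iff {L₁ L₂ : Language Bool} (x : List Bool) :
    x ∈ L₁ ⊔ L₂ ↔ x ∈ L₁ ∨ x ∈ L₂ :=
  Iff.rfl

/-- Membership in a meet of languages (definitional). -/
theorem mem_inf_language_iff {L₁ L₂ : Language Bool} (x : List Bool) :
    x ∈ L₁ ⊓ L₂ ↔ x ∈ L₁ ∧ x ∈ L₂ :=
  Iff.rfl

/-- Membership in the complement of a language (definitional). -/
theorem mem_compl_language_iff {L : Language Bool} (x : List Bool) : x ∈ Lᶜ ↔ x ∉ L :=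
  Iff.rfl

/-- `P/poly` is closed under binary union (from the tree's closure under complement and
intersection). [folklore] -/
theorem sup_mem_PPoly {L₁ L₂ : Language Bool} (h₁ : L₁ ∈ PPoly) (h₂ : L₂ ∈ PPoly) :
    L₁ ⊔ L₂ ∈ PPoly := by
  have h := compl_mem_PPoly (Literature.Computability.AlgebraicComplexity.inter_mem_PPoly
    (compl_mem_PPoly h₁) (compl_mem_PPoly h₂))
  rwa [compl_inf, compl_compl, compl_compl] at h

/-- **The small-length splice.** A language agreeing with a `P/poly` language on all words of length
`≥ n₀` is in `P/poly` (the short words have bounded length). [folklore] -/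
theorem mem_PPoly_of_eventually_agree {L L' : Language Bool} (n₀ : ℕ) (hL : L ∈ PPoly)
    (h : ∀ x : List Bool, n₀ ≤ x.length → (x ∈ L ↔ x ∈ L')) : L' ∈ PPoly := by
  let Short : Language Bool := {x : List Bool | x.length < n₀}
  have hmemS : ∀ x : List Bool, x ∈ Short ↔ x.length < n₀ := fun x => Iff.rfl
  have hS : Short ∈ PPoly := mem_PPoly_of_forall_length_lt n₀ fun x hx => (hmemS x).1 hx
  have hS' : L' ⊓ Short ∈ PPoly :=
    mem_PPoly_of_forall_length_lt n₀ fun x hx => (hmemS x).1 ((mem_inf_language_iff x).1 hx).2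
  have hLS : L ⊓ Shortᶜ ∈ PPoly :=
    Literature.Computability.AlgebraicComplexity.inter_mem_PPoly hL (compl_mem_PPoly hS)
  have e : L' = (L ⊓ Shortᶜ) ⊔ (L' ⊓ Short) := by
    ext x
    rw [mem_sup_language_iff, mem_inf_language_iff, mem_inf_language_iff, mem_compl_language_iff,
      hmemS, not_lt]
    constructor
    · intro hx
      by_cases hn : n₀ ≤ x.length
      · exact Or.inl ⟨(h x hn).2 hx, hn⟩
      · exact Or.inr ⟨hx, lt_of_not_ge hn⟩
    · rintro (⟨hx, hn⟩ | ⟨hx, -⟩)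
      · exact (h x hn).1 hx
      · exact hx
  rw [e]
  exact sup_mem_PPoly hLS hS'

/-! ### The closure theorem -/

/-- **`P/poly` is closed downwards under one-sided randomized polynomial-time many-one reductions
with success probability `≥ 1/q(n)` for `n ≥ n₀`** (Adleman 1978 relativised; RUR reductions in the
sense of Micciancio 2001, §2). Data: `f ∈ FP` reading `⟨x, r⟩ = boolPair x r`; seed length `ℓ(n) ≤
q(n)`; NO side exact for every seed; YES side: `2^{ℓ(n)} ≤ q(n) · #{r ∈ {0,1}^{ℓ(n)} : f ⟨x, r⟩ ∈ L₂}`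
for `x ∈ L₁`, `|x| = n ≥ n₀`. [folklore] -/
theorem mem_PPoly_of_rurReduction :
    ∀ (L₁ L₂ : Language Bool) (f : List Bool → List Bool), f ∈ FP → ∀ (ℓ : ℕ → ℕ) (q : Polynomial ℕ) (n₀ : ℕ), (∀ n, ℓ n ≤ q.eval n) → (∀ x : List Bool, x ∉ L₁ → ∀ r : List Bool, f (boolPair x r) ∉ L₂) → (∀ x : List Bool, x ∈ L₁ → n₀ ≤ x.length → 2 ^ (ℓ x.length) ≤ q.eval x.length * (Finset.univ.filter (fun r : Fin (ℓ x.length) → Bool => f (boolPair x (List.ofFn r)) ∈ L₂)).card) → L₂ ∈ PPoly → L₁ ∈ PPoly := by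
  intro L₁ L₂ f hf ℓ q n₀ hℓ hNO hYES h₂
  -- per length `n`: the YES-instances (as bit vectors) and their good seeds
  let M : ∀ n : ℕ, Finset (Fin n → Bool) := fun n =>
    Finset.univ.filter (fun v : Fin n → Bool => List.ofFn v ∈ L₁)
  let G : ∀ n : ℕ, (Fin n → Bool) → Finset (Fin (ℓ n) → Bool) := fun n v =>
    Finset.univ.filter (fun r : Fin (ℓ n) → Bool => f (boolPair (List.ofFn v) (List.ofFn r)) ∈ L₂)
  -- a hitting tuple of seeds exists at every length `n ≥ n₀` with `q n ≥ 1`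
  have key : ∀ n, n₀ ≤ n → 1 ≤ q.eval n →
      ∃ t : Fin ((n + 1) * q.eval n) → (Fin (ℓ n) → Bool), ∀ v ∈ M n, ∃ j, t j ∈ G n v := by
    intro n hn hq
    refine stub_hittingSet (Fin (ℓ n) → Bool) (Fin n → Bool) (M n) (G n) n (q.eval n) hq ?_ ?_
    · calc (M n).card ≤ (Finset.univ : Finset (Fin n → Bool)).card := Finset.card_le_univ _
        _ = 2 ^ n := by simp
    · intro v hv
      have hvL : List.ofFn v ∈ L₁ := (Finset.mem_filter.1 hv).2
      have hlen : (List.ofFn v).length = n := List.length_ofFn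
      have h := hYES (List.ofFn v) hvL (by rw [hlen]; exact hn)
      rw [hlen] at h
      simpa [Fintype.card_fun, Fintype.card_bool, Fintype.card_fin] using h
  -- the seed lists
  choose t ht using key
  let R : ℕ → List (List Bool) := fun n =>
    if h : n₀ ≤ n ∧ 1 ≤ q.eval n then
      (List.finRange ((n + 1) * q.eval n)).map (fun j => List.ofFn (t n h.1 h.2 j))
    else []
  -- their sizes
  have hRlen : ∀ n, (R n).length ≤ ((Polynomial.X + 1) * q).eval n := by
    intro n
    simp only [R]
    split_ifs with h
    · simp [Polynomial.eval_mul, Polynomial.eval_add, Polynomial.eval_X, Polynomial.eval_one]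
    · simp
  have hq_le : ∀ n, q.eval n ≤ ((Polynomial.X + 1) * q).eval n := by
    intro n
    simp only [Polynomial.eval_mul, Polynomial.eval_add, Polynomial.eval_X, Polynomial.eval_one]
    exact Nat.le_mul_of_pos_left _ (by omega)
  have hRmem : ∀ n, ∀ r ∈ R n, r.length ≤ ((Polynomial.X + 1) * q).eval n := by
    intro n r hr
    simp only [R] at hr
    split_ifs at hr with h
    · obtain ⟨j, -, rfl⟩ := List.mem_map.1 hr
      rw [List.length_ofFn]
      exact (hℓ n).trans (hq_le n)
    · simp at hr
  -- the derandomised language and its agreement with `L₁` from length `n₀` on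
  have hL' := stub_seedListPPoly L₂ f hf h₂ R ((Polynomial.X + 1) * q) hRlen hRmem
  refine mem_PPoly_of_eventually_agree n₀ hL' fun x hx => ?_
  constructor
  · -- derandomised YES ⇒ YES (exactness of the NO side)
    rintro ⟨r, -, hr⟩
    by_contra hxL
    exact hNO x hxL r hr
  · -- YES ⇒ some listed seed hits
    intro hxL
    have hq : 1 ≤ q.eval x.length := by
      by_contra hq0
      have h0 : q.eval x.length = 0 := by omega
      have h := hYES x hxL hx
      rw [h0, zero_mul] at h
      exact absurd h (not_le.2 (by positivity))
    have hv : (x.get : Fin x.length → Bool) ∈ M x.length := by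
      simp only [M, Finset.mem_filter, Finset.mem_univ, true_and, List.ofFn_get]
      exact hxL
    obtain ⟨j, hj⟩ := ht x.length hx hq x.get hv
    refine ⟨List.ofFn (t x.length hx hq j), ?_, ?_⟩
    · have hcond : n₀ ≤ x.length ∧ 1 ≤ q.eval x.length := ⟨hx, hq⟩
      simp only [R, dif_pos hcond]
      exact List.mem_map.2 ⟨j, List.mem_finRange j, rfl⟩
    · have h := (Finset.mem_filter.1 hj).2
      rwa [List.ofFn_get] at h

end Summit.QuantumAdvantage.QuantumAdvantage.Theorems.IqThreeNotPPoly

end
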